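import Summits.ResolutionOfSingularities.ResolutionOfSingularities.Theorems.PurelyInseparableDim4ScopeDivEdge
import Summits.ResolutionOfSingularities.ResolutionOfSingularities.Theorems.PurelyInseparableDim4ScopeWitness
import Summits.ResolutionOfSingularities.ResolutionOfSingularities.Theorems.PurelyInseparableDim4IsolatedScope
import Summits.ResolutionOfSingularities.ResolutionOfSingularities.Theorems.PurelyInseparableDim4Perm2BoundOrigin
import Summits.ResolutionOfSingularities.ResolutionOfSingularities.Theorems.PurelyInseparableDim4NearDim
import Literature.AlgebraicGeometry.Resolution.PointBlowupKangaroo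
import HarnessLib

/-!
# [OURS · res-dim4-pi · F4-C] SCOPE DYNAMICS, part 2: a SCOPE-LOSS specimen — an in-scope state whose
  FORCED MODE-1h divisor step (read at the chart origin) lands OUT of coordinate scope (`p = q = 2`)

Cell `res-dim4-pi` (D-0157 DOOR 2, wave 2), seat `res-dim4-p-6`, desk WORD #31 (c); sequel of
`PurelyInseparableDim4ScopeDynamics` (§3: along a spine DIV edge `J_p⁺(F) = (x_j^p)·J_p⁺(F′)`, so the child's
`p`-fold locus is the parent's with the hyperplane `V(x_j)` removed and a component hidden inside `V(x_j)` can
surface).  Here is the smallest such surfacing, over EVERY field of characteristic `2`: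

  parent `F = x₁³x₂ + x₁³x₃x₄ = x₁³·(x₂ + x₃x₄)`,   child `F′ = x₁x₂ + x₁x₃x₄ = x₁·(x₂ + x₃x₄)`.

* `isPermissibleCentre_iff` — the Hironaka-permissible coordinate centres of `F` are exactly the `S ∋ x₁`
  (`ord_{(x₁)} F = 3 ≥ 2`), so **the divisor `{x₁}` is the UNIQUE MODE-1h centre** (`isMode1hCentre_iff`);
* `inCoordinateScope_parent` — `F` is IN SCOPE: `J₂⁺(F) = x₁²·(x₂ + x₃x₄, x₁)` has the single minimal prime
  `(x₁)` (a coordinate ideal);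
* `step_F_parent` — the step along `{x₁}` at the chart origin gives `F′` (division by `x₁²`), an `Edge`, indeed a
  `SpineEdge`, of MODE 1h (`step1h_parent`);
* `not_inCoordinateScope_child` — `F′` is OUT OF SCOPE: `J₂⁺(F′) = (x₁, x₂ + x₃x₄)` is a regular
  NON-coordinate prime (branch `(0, t², t, t)`; p-14's curve certificate
  `IsolationCert.not_inCoordinateScope_two_of_powerSeriesCurve`) — the child is the uniform trap's shape
  `x₁ · w` (p-13), i.e. BLIND-REGULAR;
* **`exists_scope_loss`** — hence over every field of characteristic `2` there are states `s ⟶ s′` with `s` clean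
  and in scope, `Step1h 2 s s′` a spine edge along the FORCED centre, and `s′` out of scope: «in scope» is not an
  invariant of the MODE-1h walk, already at its first forced divisor step.

[OURS · counted 0 · ‖ K specimen about OUR frame; AI kernel work, weaker than expert review.]  NOTHING here is a
statement about resolution of singularities; resolution in dimension `≥ 4` / characteristic `p > 0` is NOT
proved by anything in this file.  bears_on: LADDER-RESOLUTION:D157-DOOR2 (res-dim4-pi · F4-C SCOPE DYNAMICS).
Host item (DR-157-C): `stmt-ResolutionOfSingularities-16155`.
-/

noncomputable section

set_option linter.dupNamespace false -- mandated namespace of this single-conjunct summit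

open MvPolynomial Finset

namespace Summit.ResolutionOfSingularities.ResolutionOfSingularities.Theorems.PIDim4

namespace ScopeLoss

open Literature.AlgebraicGeometry.Resolution
open Literature.AlgebraicGeometry.Resolution.CentreBlowup
open Literature.AlgebraicGeometry.Resolution.Hauser2010

variable {K : Type} [Field K]

/-! ## §1 The specimen: the data -/



/-- exponent of `x₁³x₂`. [folklore] -/
def e31 : Fin 4 →₀ ℕ := Finsupp.equivFunOnFinite.symm ![3, 1, 0, 0]
/-- exponent of `x₁³x₃x₄`. [folklore] -/
def e3011 : Fin 4 →₀ ℕ := Finsupp.equivFunOnFinite.symm ![3, 0, 1, 1]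
/-- exponent of `x₁x₂`. [folklore] -/
def e11 : Fin 4 →₀ ℕ := Finsupp.equivFunOnFinite.symm ![1, 1, 0, 0]
/-- exponent of `x₁x₃x₄`. [folklore] -/
def e1011 : Fin 4 →₀ ℕ := Finsupp.equivFunOnFinite.symm ![1, 0, 1, 1]

/-- Pointwise values of `e31`. -/
@[simp] theorem e31_apply (i : Fin 4) : e31 i = ![3, 1, 0, 0] i := rfl
/-- Pointwise values of `e3011`. -/
@[simp] theorem e3011_apply (i : Fin 4) : e3011 i = ![3, 0, 1, 1] i := rfl
/-- Pointwise values of `e11`. -/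
@[simp] theorem e11_apply (i : Fin 4) : e11 i = ![1, 1, 0, 0] i := rfl
/-- Pointwise values of `e1011`. -/
@[simp] theorem e1011_apply (i : Fin 4) : e1011 i = ![1, 0, 1, 1] i := rfl

/-- The parent `F = x₁³x₂ + x₁³x₃x₄`. [folklore] -/
def Fp : MvPolynomial (Fin 4) K := monomial e31 1 + monomial e3011 1
/-- The child `F′ = x₁x₂ + x₁x₃x₄`. [folklore] -/
def Fc : MvPolynomial (Fin 4) K := monomial e11 1 + monomial e1011 1

/-- `e31 ≠ e3011`. -/
theorem e31_ne : e31 ≠ e3011 := fun h => by have := DFunLike.congr_fun h 1; simp at this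
/-- `e11 ≠ e1011`. -/
theorem e11_ne : e11 ≠ e1011 := fun h => by have := DFunLike.congr_fun h 1; simp at this

/-- `e31` as a sum of singles. -/
theorem single_e31 : Finsupp.single (0 : Fin 4) 3 + Finsupp.single 1 1 = e31 := by
  ext i; fin_cases i <;> simp
/-- `e3011` as a sum of singles. -/
theorem single_e3011 : Finsupp.single (0 : Fin 4) 3 + Finsupp.single 2 1 + Finsupp.single 3 1 = e3011 := by
  ext i; fin_cases i <;> simp
/-- `e11` as a sum of singles. -/
theorem single_e11 : Finsupp.single (0 : Fin 4) 1 + Finsupp.single 1 1 = e11 := by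
  ext i; fin_cases i <;> simp
/-- `e1011` as a sum of singles. -/
theorem single_e1011 : Finsupp.single (0 : Fin 4) 1 + Finsupp.single 2 1 + Finsupp.single 3 1 = e1011 := by
  ext i; fin_cases i <;> simp

/-- `F` written with variables. -/
theorem Fp_eq_X : (Fp : MvPolynomial (Fin 4) K) = X 0 ^ 3 * X 1 + X 0 ^ 3 * X 2 * X 3 := by
  have h1 : (X 0 ^ 3 * X 1 : MvPolynomial (Fin 4) K) = monomial e31 1 := by
    rw [X_pow_eq_monomial, X, monomial_mul, one_mul, single_e31]
  have h2 : (X 0 ^ 3 * X 2 * X 3 : MvPolynomial (Fin 4) K) = monomial e3011 1 := by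
    rw [X_pow_eq_monomial, X, X, monomial_mul, monomial_mul, one_mul, one_mul, single_e3011]
  rw [Fp, h1, h2]

/-- `F′` written with variables. -/
theorem Fc_eq_X : (Fc : MvPolynomial (Fin 4) K) = X 0 * X 1 + X 0 * X 2 * X 3 := by
  have h1 : (X 0 * X 1 : MvPolynomial (Fin 4) K) = monomial e11 1 := by
    rw [X, X, monomial_mul, one_mul, single_e11]
  have h2 : (X 0 * X 2 * X 3 : MvPolynomial (Fin 4) K) = monomial e1011 1 := by
    rw [X, X, X, monomial_mul, monomial_mul, one_mul, one_mul, single_e1011]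
  rw [Fc, h1, h2]

/-- `x₁² · F′ = F`. -/
theorem X_sq_mul_Fc : (X 0 : MvPolynomial (Fin 4) K) ^ 2 * Fc = Fp := by
  rw [Fc_eq_X, Fp_eq_X]; ring

/-- The support of `F`. -/
theorem support_Fp_subset : (Fp : MvPolynomial (Fin 4) K).support ⊆ {e31, e3011} := by
  intro d hd
  rw [Fp, MvPolynomial.mem_support_iff, coeff_add, coeff_monomial, coeff_monomial] at hd
  simp only [Finset.mem_insert, Finset.mem_singleton]
  by_contra h
  push Not at h
  rw [if_neg (Ne.symm h.1), if_neg (Ne.symm h.2), add_zero] at hd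
  exact hd rfl

/-- The coefficient of `x₁³x₂` in `F` is `1`, so `F ≠ 0`. -/
theorem Fp_ne_zero : (Fp : MvPolynomial (Fin 4) K) ≠ 0 := by
  intro h
  have : coeff e31 (Fp : MvPolynomial (Fin 4) K) = 1 := by
    rw [Fp, coeff_add, coeff_monomial, coeff_monomial, if_pos rfl, if_neg e31_ne.symm, add_zero]
  rw [h, coeff_zero] at this
  exact zero_ne_one this

/-- `F` is clean (no square monomials). -/
theorem deletePthPowers_Fp : deletePthPowers 2 (Fp : MvPolynomial (Fin 4) K) = Fp := by
  have h1 : ¬ IsPthPowerExponent 2 e31 := fun h => by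
    have := (isPthPowerExponent_iff 2 e31).mp h 1; simp at this
  have h2 : ¬ IsPthPowerExponent 2 e3011 := fun h => by
    have := (isPthPowerExponent_iff 2 e3011).mp h 2; simp at this
  rw [Fp, deletePthPowers_add, deletePthPowers_monomial, deletePthPowers_monomial, if_neg h1, if_neg h2]

/-! ## §2 The permissible centres: exactly the `S ∋ x₁`; the divisor is the forced MODE-1h centre -/

/-- `ord_{(x₁)} F ≥ 2` — indeed `3`. -/
theorem two_le_ordAlong_zero : (2 : ℕ∞) ≤ ordAlong ({0} : Finset (Fin 4)) (Fp : MvPolynomial (Fin 4) K) := by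
  refine le_ordAlong_of_forall (n := 2) fun d hd => ?_
  have hd' := support_Fp_subset hd
  simp only [Finset.mem_insert, Finset.mem_singleton] at hd'
  rcases hd' with rfl | rfl <;> simp [degIn_singleton]

/-- **The permissible coordinate centres of `F` are exactly the `S` containing `x₁`.** [folklore] -/
theorem isPermissibleCentre_iff (S : Finset (Fin 4)) :
    IsPermissibleCentre 2 S (Fp : MvPolynomial (Fin 4) K) ↔ (0 : Fin 4) ∈ S := by
  constructor
  · rintro ⟨-, hS⟩
    by_contra h0
    -- the monomial `x₁³x₂` has `S`-degree `≤ 1` when `x₁ ∉ S`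
    have hmem : e31 ∈ (Fp : MvPolynomial (Fin 4) K).support := by
      rw [MvPolynomial.mem_support_iff, Fp, coeff_add, coeff_monomial, coeff_monomial, if_pos rfl,
        if_neg e31_ne.symm, add_zero]
      exact one_ne_zero
    have h2 : (2 : ℕ∞) ≤ (degIn S e31 : ℕ∞) := hS.trans (ordAlong_le_of_mem_support hmem)
    have h2' : 2 ≤ degIn S e31 := by exact_mod_cast h2
    have hsub : S ⊆ ({1, 2, 3} : Finset (Fin 4)) := by
      intro i hi
      fin_cases i
      · exact absurd hi h0
      all_goals simp
    have hle : degIn S e31 ≤ degIn ({1, 2, 3} : Finset (Fin 4)) e31 := degIn_mono hsub e31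
    have hval : degIn ({1, 2, 3} : Finset (Fin 4)) e31 = 1 := by simp [degIn]
    omega
  · intro h0
    exact ⟨⟨0, h0⟩, two_le_ordAlong_zero.trans (ordAlong_mono (Finset.singleton_subset_iff.mpr h0) _)⟩

/-- **The divisor `{x₁}` is the unique MODE-1h centre of `F`.** [folklore] -/
theorem isMode1hCentre_iff (S : Finset (Fin 4)) :
    IsMode1hCentre 2 S (Fp : MvPolynomial (Fin 4) K) ↔ S = {0} := by
  constructor
  · rintro ⟨hS, hmin⟩
    have h0 : (0 : Fin 4) ∈ S := (isPermissibleCentre_iff S).mp hS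
    have hcard : S.card ≤ 1 := by
      have := hmin {0} ((isPermissibleCentre_iff {0}).mpr (Finset.mem_singleton_self 0))
      rwa [Finset.card_singleton] at this
    exact Finset.eq_singleton_iff_unique_mem.mpr
      ⟨h0, fun i hi => Finset.card_le_one.mp hcard i hi 0 h0⟩
  · rintro rfl
    refine ⟨(isPermissibleCentre_iff {0}).mpr (Finset.mem_singleton_self 0), fun S' hS' => ?_⟩
    rw [Finset.card_singleton]
    exact Finset.card_pos.mpr ⟨0, (isPermissibleCentre_iff S').mp hS'⟩

/-! ## §3 The parent is in scope -/

/-- `∂₂ F = x₁³`. -/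
theorem pderiv_one_Fp : pderiv 1 (Fp : MvPolynomial (Fin 4) K) = X 0 ^ 3 := by
  rw [Fp_eq_X]
  simp [map_add, (pderiv _).leibniz_pow, pderiv_X]

/-- `x₁³ ∈ J₂⁺(F)`. -/
theorem X_cube_mem : (X 0 : MvPolynomial (Fin 4) K) ^ 3 ∈ singLocusIdeal 2 (Fp : MvPolynomial (Fin 4) K) := by
  rw [IsolationCert.singLocusIdeal_two, ← pderiv_one_Fp]
  exact Ideal.subset_span ⟨1, rfl⟩

/-- **The parent is IN COORDINATE SCOPE**: the only minimal prime of `J₂⁺(F)` is `(x₁)` (it contains `J₂⁺(F)`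
since `{x₁}` is permissible — p-12's `IsolatedScope.singLocusIdeal_le_span_X` — and every prime over `J₂⁺(F)`
contains `x₁³`, hence `x₁`). [folklore] -/
theorem inCoordinateScope_parent : InCoordinateScope 2 (Fp : MvPolynomial (Fin 4) K) := by
  intro P hP _
  have hPprime : P.IsPrime := hP.1.1
  have hJP : singLocusIdeal 2 (Fp : MvPolynomial (Fin 4) K) ≤ P := hP.1.2
  have hX0 : (X 0 : MvPolynomial (Fin 4) K) ∈ P := hPprime.mem_of_pow_mem 3 (hJP X_cube_mem)
  let Q : Ideal (MvPolynomial (Fin 4) K) :=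
    Ideal.span ((fun i => (X i : MvPolynomial (Fin 4) K)) '' (({0} : Finset (Fin 4)) : Set (Fin 4)))
  have hQP : Q ≤ P := by
    rw [Ideal.span_le]
    rintro _ ⟨i, hi, rfl⟩
    rw [Finset.coe_singleton, Set.mem_singleton_iff] at hi
    subst hi
    exact hX0
  have hQprime : Q.IsPrime := Literature.RingTheory.MvPolynomial.isPrime_span_X_image _
  have hJQ : singLocusIdeal 2 (Fp : MvPolynomial (Fin 4) K) ≤ Q :=
    IsolatedScope.singLocusIdeal_le_span_X two_le_ordAlong_zero
  have hPQ : P ≤ Q := hP.2 ⟨hQprime, hJQ⟩ hQP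
  exact ⟨{0}, le_antisymm hPQ hQP⟩

/-! ## §4 The step: the forced divisor step at the chart origin gives the child -/

/-- `chartTransform 2 {x₁} x₁ F = F′` (the DIV step is division by `x₁²`). -/
theorem chartTransform_Fp :
    chartTransform 2 ({0} : Finset (Fin 4)) 0 (Fp : MvPolynomial (Fin 4) K) = Fc := by
  have h := NearDim.X_pow_mul_chartTransform_singleton (two_le_ordAlong_zero (K := K))
  exact mul_left_cancel₀ (pow_ne_zero 2 (X_ne_zero (0 : Fin 4))) (h.trans X_sq_mul_Fc.symm)

/-- The transform at the chart origin is `F′`. -/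
theorem pointTransform_parent (r : Fin 4 →₀ ℕ) (exc : Finset (Fin 4)) :
    pointTransform 2 ({0} : Finset (Fin 4)) 0 (0 : Fin 4 → K) ⟨Fp, r, exc⟩ = Fc := by
  rw [pointTransform, PointBlowup.translate_zero]
  exact chartTransform_Fp

/-- The chart origin is an equimultiple point (`F′` has no monomial of degree `1`). -/
theorem isEquimultiplePoint_parent [DecidableEq K] (r : Fin 4 →₀ ℕ) (exc : Finset (Fin 4)) :
    IsEquimultiplePoint 2 ({0} : Finset (Fin 4)) 0 (0 : Fin 4 → K) ⟨Fp, r, exc⟩ := by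
  intro d _ hdeg
  rw [pointTransform_parent, Fc, coeff_add, coeff_monomial, coeff_monomial]
  have hdeg' : d 0 + d 1 + d 2 + d 3 < 2 := by
    rw [← degIn_univ] at hdeg; simpa [degIn, Fin.sum_univ_four] using hdeg
  have h1 : e11 ≠ d := by rintro rfl; simp at hdeg'
  have h2 : e1011 ≠ d := by rintro rfl; simp at hdeg'
  rw [if_neg h1, if_neg h2, add_zero]

/-- **The forced divisor step at the chart origin maps `F` to `F′`.** -/
theorem step_F_parent [DecidableEq K] (r : Fin 4 →₀ ℕ) (exc : Finset (Fin 4)) :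
    (CentreBlowup.step 2 ({0} : Finset (Fin 4)) 0 (0 : Fin 4 → K) ⟨Fp, r, exc⟩).F = Fc := by
  rw [Perm2Bound.step_F_origin (Finset.mem_singleton_self 0) (0 : Fin 4 → K) (fun _ => rfl)
    ⟨Fp, r, exc⟩ deletePthPowers_Fp (NearDim.forall_le_degIn_of_le_ordAlong two_le_ordAlong_zero)]
  exact chartTransform_Fp

/-- `F′ ≠ 0`. -/
theorem Fc_ne_zero : (Fc : MvPolynomial (Fin 4) K) ≠ 0 := by
  intro h
  have : coeff e11 (Fc : MvPolynomial (Fin 4) K) = 1 := by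
    rw [Fc, coeff_add, coeff_monomial, coeff_monomial, if_pos rfl, if_neg e11_ne.symm, add_zero]
  rw [h, coeff_zero] at this
  exact zero_ne_one this

/-- The divisor step at the origin is a SPINE edge of MODE 1h. -/
theorem spineEdge_parent [DecidableEq K] (r : Fin 4 →₀ ℕ) (exc : Finset (Fin 4)) :
    SpineEdge 2 ({0} : Finset (Fin 4)) (⟨Fp, r, exc⟩ : State K)
      (CentreBlowup.step 2 ({0} : Finset (Fin 4)) 0 (0 : Fin 4 → K) ⟨Fp, r, exc⟩) :=
  ⟨0, Finset.mem_singleton_self 0, isEquimultiplePoint_parent r exc,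
    by rw [step_F_parent]; exact Fc_ne_zero, rfl⟩

/-- … hence a MODE-1h step. -/
theorem step1h_parent [DecidableEq K] (r : Fin 4 →₀ ℕ) (exc : Finset (Fin 4)) :
    Step1h 2 (⟨Fp, r, exc⟩ : State K) (CentreBlowup.step 2 ({0} : Finset (Fin 4)) 0 (0 : Fin 4 → K) ⟨Fp, r, exc⟩) :=
  ⟨{0}, (isMode1hCentre_iff {0}).mpr rfl, edge_of_spineEdge 2 _ _ _ (spineEdge_parent r exc)⟩

/-! ## §5 The child is out of scope -/

/-- **The child `F′ = x₁(x₂ + x₃x₄)` is OUT OF COORDINATE SCOPE** over every field of characteristic `2`: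
`J₂⁺(F′) = (x₂ + x₃x₄, x₁)` vanishes along the branch `(0, t², t, t)` (which leaves every coordinate subspace
other than `V(x₁)`), while `∂₁F′ = x₂ + x₃x₄` does not vanish at `(0,1,0,0) ∈ V(x₁)` (p-14's curve
certificate). [folklore] -/
theorem not_inCoordinateScope_child [CharP K 2] : ¬ InCoordinateScope 2 (Fc : MvPolynomial (Fin 4) K) := by
  have h2 : (2 : PowerSeries K) = 0 := by
    rw [← map_ofNat (algebraMap K (PowerSeries K)) 2, CharTwo.two_eq_zero, map_zero]
  have hPP : ∀ P : PowerSeries K, P + P = 0 := fun P => by rw [← two_mul, h2, zero_mul]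
  rw [Fc_eq_X]
  refine IsolationCert.not_inCoordinateScope_two_of_powerSeriesCurve
    (fun k => if k = 0 then 0 else if k = 1 then PowerSeries.X * PowerSeries.X else PowerSeries.X)
    (fun k => ?_) {0} (fun i hi => ?_) (fun k => ?_) 0 (fun k => if k = 1 then 1 else 0) (fun i hi => ?_) ?_
  · fin_cases k <;> simp
  · fin_cases i <;> simp_all [PowerSeries.X_ne_zero]
  · fin_cases k
    all_goals simp [map_add, map_mul, pderiv_X]
    all_goals exact hPP _
  · fin_cases i <;> simp_all
  · simp [map_add, map_mul, pderiv_X]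

/-! ## §6 The located frame facts -/

/-- **SCOPE IS LOST AT THE FIRST FORCED DIVISOR STEP** (every field of characteristic `2`): there are states
`s ⟶ s′` with `s` clean and in coordinate scope, the MODE-1h centre of `s` FORCED (every MODE-1h centre is the
divisor `{x₁}`), `s′` its child at the chart origin along a spine edge of MODE 1h, and `s′` out of scope.
A statement about OUR frame (F4-C / TIER 2), not about resolution. [folklore] -/
theorem exists_scope_loss [CharP K 2] [DecidableEq K] :
    ∃ s s' : State K, deletePthPowers 2 s.F = s.F ∧ InCoordinateScope 2 s.F ∧
      (∀ S, IsMode1hCentre 2 S s.F → S = {0}) ∧ SpineEdge 2 {0} s s' ∧ Step1h 2 s s' ∧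
      ¬ InCoordinateScope 2 s'.F := by
  refine ⟨⟨Fp, 0, ∅⟩, CentreBlowup.step 2 ({0} : Finset (Fin 4)) 0 (0 : Fin 4 → K) ⟨Fp, 0, ∅⟩,
    deletePthPowers_Fp, inCoordinateScope_parent, fun S hS => (isMode1hCentre_iff S).mp hS,
    spineEdge_parent 0 ∅, step1h_parent 0 ∅, ?_⟩
  rw [step_F_parent]
  exact not_inCoordinateScope_child


/-- **In the specimen a NON-coordinate component SURFACES inside `V(x₁)`** (the dictionary's second clause
fails at the first forced step): some minimal prime of the child's `J₂⁺` through the origin contains `x₁` and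
is not a coordinate ideal (it is `(x₁, x₂ + x₃x₄)`). [folklore] -/
theorem exists_surfacing_component [CharP K 2] [DecidableEq K] (r : Fin 4 →₀ ℕ) (exc : Finset (Fin 4)) :
    ∃ P ∈ (singLocusIdeal 2
        (CentreBlowup.step 2 ({0} : Finset (Fin 4)) 0 (0 : Fin 4 → K) ⟨Fp, r, exc⟩).F).minimalPrimes,
      P ≤ originIdeal K ∧ (X 0 : MvPolynomial (Fin 4) K) ∈ P ∧ ¬ IsCoordinateIdeal P := by
  have hc : ¬ InCoordinateScope 2
      (CentreBlowup.step 2 ({0} : Finset (Fin 4)) 0 (0 : Fin 4 → K) ⟨Fp, r, exc⟩).F := by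
    rw [step_F_parent]
    exact not_inCoordinateScope_child
  rw [ScopeDynamics.inCoordinateScope_step_iff 2 (⟨Fp, r, exc⟩ : State K) deletePthPowers_Fp two_le_ordAlong_zero] at hc
  push Not at hc
  exact hc inCoordinateScope_parent

end ScopeLoss

end Summit.ResolutionOfSingularities.ResolutionOfSingularities.Theorems.PIDim4

end
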